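import Mathlib
import HarnessLib
import Literature.MathematicalPhysics.KineticTheory.VelocityFlipNoise
import Literature.MathematicalPhysics.KineticTheory.VelocityFlipEmbeddedChainSteadyState
import Literature.Probability.Process.HarrisTheorem
import Summits.AtomisticToContinuum.FouriersLaw.Theorems.BondHeatUncertaintyLightConeBondHeatBondCorrelation

/-!
# Mild Abel correctors of the velocity-flip pinned chain exist (stub `stub_abelCorrectorExists`, part 1)

`--supports stmt-AtomisticToContinuum-11977` helper file (crux `VanishingNoiseTransfer.NoisyFourier`, line
`abel-kapitza-even-corrector`, stub `stub_abelCorrectorExists`, part 1 of 3).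

For the pinned chain `pinnedChain ω₂ lam β γ` (all parameters `> 0`), `N ≥ 2` sites, a temperature `T > 0`, a flip
rate `ε > 0` and an Abel parameter `s > 0`, the classical Abel corrector `u = (s − L − εS)⁻¹ J`
(`J = Σ_i j_i` the total current, `S u = Σ_i (u ∘ F_i − u)` the flip noise) is first constructed in MILD
(resolvent) form. With `r = s + Nε` and `R_r` the (Markov-normalised) resolvent kernel of the FLIP-FREE
Langevin dynamics at `(T, T)` (`LangevinChainSemigroup.resolventKernel`, `R_r = r (r − L)⁻¹`), the equation
`(s − L − εS) u = J` reads `(r − L) u = J + ε Σ_i u ∘ F_i`, i.e.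
`u = R_r (r⁻¹ (J + ε Σ_i u ∘ F_i))`.

* `abs_totalCurrent_le_exp` — `|J| ≤ C e^{θH}` (`θ > 0`).
* `abel_mildCorrector_exists` — there is a measurable `u` with `|u| ≤ C e^{H/(4T)}` solving the mild equation
  pointwise. Proof: a plain Banach iteration `u = Σ_n Gⁿ ψ`, `ψ = R_r(r⁻¹ J)`, `G f = R_r (r⁻¹ ε Σ_i f ∘ F_i)`,
  in the weighted sup norm of `W = e^{θH} + c₀` (`θ = 1/(4T)`): the Lyapunov bound
  `R_r e^{θH} ≤ e^{θH} + K₀` (`pinnedChain_lintegral_exp_hamiltonian_resolventKernel_le`) and flip invariance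
  of `H` give `|G f| ≤ q ‖f‖_W W` with `q = (Nε + s/2)/(Nε + s) < 1` once `c₀ = 2NεK₀/s`.
* `helper_abelCorrectorMild` — registered helper (notation-free restatement).

References: Bernardin–Olla 2011 §2.1 and §5 (the resolvent `(λ − L)⁻¹ j`); Ethier–Kurtz 1986 Ch. 1 §2
(resolvents of Markov semigroups); Cuneo–Eckmann–Hairer–Rey-Bellet 2018 Thm 5.1 (Lyapunov function `e^{θH}`).
-/

noncomputable section

open MeasureTheory ProbabilityTheory Filter Topology Set
open scoped NNReal ENNReal BigOperators
open Literature.MathematicalPhysics.KineticTheory.HeatConduction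
open Literature.Probability.Process OscillatorChain
open Summit.AtomisticToContinuum.FouriersLaw.Theorems.LightConeBondHeat (pinnedChain_abs_bondCurrent_le_exp)

namespace Summit.AtomisticToContinuum.FouriersLaw.Cruxes.NoisyFourier.AbelKapitzaEvenCorrector

section Mild

variable {ω₂ lam β γ : ℝ} {N : ℕ}

/-- **The total current is of exponential class**: `|Σ_i j_i| ≤ C e^{θH}` for every `θ > 0`
(`pinnedChain_abs_bondCurrent_le_exp` summed over the bonds). [folklore] -/
theorem abs_totalCurrent_le_exp (hω : 0 ≤ ω₂) (hl : 0 ≤ lam) (hβ : 0 ≤ β) (γ : ℝ) {θ : ℝ} (hθ : 0 < θ) :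
    ∃ C : ℝ, 0 ≤ C ∧ ∀ y : PhaseSpace N, |∑ i : Fin N, (pinnedChain ω₂ lam β γ).bondCurrent N i y| ≤
      C * Real.exp (θ * (pinnedChain ω₂ lam β γ).hamiltonian N y) := by
  refine ⟨N * (N * ((3 + β) / 2) * (2 * Real.exp θ / θ ^ 2)), by positivity, fun y => ?_⟩
  calc |∑ i : Fin N, (pinnedChain ω₂ lam β γ).bondCurrent N i y|
      ≤ ∑ i : Fin N, |(pinnedChain ω₂ lam β γ).bondCurrent N i y| := Finset.abs_sum_le_sum_abs _ _
    _ ≤ ∑ _i : Fin N, (N * ((3 + β) / 2) * (2 * Real.exp θ / θ ^ 2)) *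
          Real.exp (θ * (pinnedChain ω₂ lam β γ).hamiltonian N y) :=
        Finset.sum_le_sum fun i _ => pinnedChain_abs_bondCurrent_le_exp hω hl hβ γ N hθ i y
    _ = N * (N * ((3 + β) / 2) * (2 * Real.exp θ / θ ^ 2)) *
          Real.exp (θ * (pinnedChain ω₂ lam β γ).hamiltonian N y) := by
        rw [Finset.sum_const, Finset.card_univ, Fintype.card_fin, nsmul_eq_mul]; ring

/-- **Mild Abel correctors exist.** For the pinned chain (all parameters `> 0`), `N ≥ 2`, `T > 0`, `ε > 0`,
`s > 0`: there is a measurable `u` with `|u| ≤ C e^{H/(4T)}` and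
`u(z) = ∫ r⁻¹ (J + ε Σ_i u ∘ F_i) dR_r(z, ·)` for all `z`, `r = s + Nε`, `R_r` the resolvent kernel of the
flip-free dynamics at `(T, T)` — the resolvent form of `(L + εS) u = s u − J`. Banach iteration in the
`e^{H/(4T)} + c₀`-weighted sup norm (see the module docstring).
[cite: BernardinOlla2011, §5] -/
theorem abel_mildCorrector_exists (hω : 0 < ω₂) (hl : 0 < lam) (hβ : 0 < β) (hγ : 0 < γ) (hN : 1 < N)
    {T : ℝ} (hT : 0 < T) {ε : ℝ} (hε : 0 < ε) {s : ℝ} (hs : 0 < s) :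
    ∃ u : PhaseSpace N → ℝ, Measurable u ∧
      (∃ C : ℝ, ∀ z, |u z| ≤ C * Real.exp (1 / (4 * T) * (pinnedChain ω₂ lam β γ).hamiltonian N z)) ∧
      ∀ z, u z = ∫ y, (s + (N : ℝ) * ε)⁻¹ * ((∑ i : Fin N, (pinnedChain ω₂ lam β γ).bondCurrent N i y) +
          ε * ∑ i : Fin N, u (momentumFlip i y))
        ∂((pinnedChainSemigroup hω hl.le hβ.le hγ.le (Nat.zero_lt_of_lt hN) hT.le hT.le).resolventKernel
          (s + (N : ℝ) * ε) z) := by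
  have hN0 : 0 < N := Nat.zero_lt_of_lt hN
  have hNr : (0 : ℝ) < N := by exact_mod_cast hN0
  set P := pinnedChain ω₂ lam β γ with hP
  set Sg := pinnedChainSemigroup hω hl.le hβ.le hγ.le hN0 hT.le hT.le with hSg
  set r : ℝ := s + (N : ℝ) * ε with hr_def
  have hr : 0 < r := by positivity
  set R := Sg.resolventKernel r with hRdef
  haveI hRM : IsMarkovKernel R := Sg.isMarkovKernel_resolventKernel hr
  set H : PhaseSpace N → ℝ := P.hamiltonian N with hH
  have hHc : Continuous H := pinnedChain_continuous_hamiltonian ω₂ lam β γ N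
  have hH0 : ∀ x, 0 ≤ H x := fun x => pinnedChain_hamiltonian_nonneg hω.le hl.le hβ.le γ N x
  set θ : ℝ := 1 / (4 * T) with hθ
  have hθ0 : 0 < θ := by positivity
  have hθ' : θ < 1 / max T T := by
    rw [max_self, hθ, div_lt_div_iff₀ (by positivity) hT]; nlinarith
  -- the Lyapunov weight `V = e^{θH}` and the shifted weight `W = V + c₀`
  let V : PhaseSpace N → ℝ≥0 := fun x => (Real.exp (θ * H x)).toNNReal
  have hVc : Continuous V := continuous_real_toNNReal.comp (Real.continuous_exp.comp (continuous_const.mul hHc))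
  have hVm : Measurable V := hVc.measurable
  have hVreal : ∀ x, ((V x : ℝ≥0) : ℝ) = Real.exp (θ * H x) := fun x => Real.coe_toNNReal _ (Real.exp_pos _).le
  have hVge1 : ∀ x, (1 : ℝ) ≤ V x := fun x => by
    rw [hVreal]; exact Real.one_le_exp (mul_nonneg hθ0.le (hH0 x))
  have hVflip : ∀ (i : Fin N) (x : PhaseSpace N), ((V (momentumFlip i x) : ℝ≥0) : ℝ) = V x := by
    intro i x; simp only [V, hH, OscillatorChain.hamiltonian_momentumFlip]
  -- (1) the Lyapunov bound `R V ≤ V + K₀`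
  obtain ⟨a, b, ha, hb, hlyR⟩ :=
    pinnedChain_lintegral_exp_hamiltonian_resolventKernel_le hω hl hβ hγ hN hT hT hr hθ0 hθ'
  lift b to ℝ≥0 using hb with K₀ hK₀
  have hdriftR : ∀ x, ∫⁻ y, (V y : ℝ≥0∞) ∂(R x) ≤ a * V x + K₀ := fun x => hlyR x
  have hVR : ∀ x, ∫⁻ y, (V y : ℝ≥0∞) ∂(R x) ≠ ⊤ := fun x =>
    ne_top_of_le_ne_top (ENNReal.add_ne_top.2 ⟨ENNReal.mul_ne_top ha.ne_top ENNReal.coe_ne_top,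
      ENNReal.coe_ne_top⟩) (hdriftR x)
  have hK₀0 : (0 : ℝ) ≤ K₀ := K₀.coe_nonneg
  have hRbound : ∀ x, (∫⁻ y, (V y : ℝ≥0∞) ∂(R x)).toReal ≤ (V x : ℝ) + K₀ := by
    intro x
    have h1 : ∫⁻ y, (V y : ℝ≥0∞) ∂(R x) ≤ (V x : ℝ≥0∞) + K₀ :=
      (hdriftR x).trans (add_le_add (mul_le_of_le_one_left zero_le ha.le) le_rfl)
    have h2 : ((V x : ℝ≥0∞) + K₀).toReal = (V x : ℝ) + K₀ := by
      rw [ENNReal.toReal_add ENNReal.coe_ne_top ENNReal.coe_ne_top]; simp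
    rw [← h2]
    exact ENNReal.toReal_mono (by simp) h1
  -- the constants of the contraction
  set c₀ : ℝ := 2 * ((N : ℝ) * ε) * K₀ / s with hc₀
  have hc₀0 : 0 ≤ c₀ := by positivity
  set q : ℝ := ((N : ℝ) * ε + s / 2) / r with hq
  have hq0 : 0 ≤ q := by positivity
  have hq1 : q < 1 := by rw [hq, div_lt_one hr, hr_def]; linarith
  have h1q : 0 < 1 - q := by linarith
  set W : PhaseSpace N → ℝ := fun x => (V x : ℝ) + c₀ with hW
  have hVW : ∀ x, (V x : ℝ) ≤ W x := fun x => by simp only [hW]; linarith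
  have hW1 : ∀ x, 1 ≤ W x := fun x => (hVge1 x).trans (hVW x)
  have hW0 : ∀ x, 0 ≤ W x := fun x => zero_le_one.trans (hW1 x)
  have hWflip : ∀ (i : Fin N) (x : PhaseSpace N), W (momentumFlip i x) = W x := by
    intro i x; simp only [hW, hVflip]
  -- integrability under `R x` and the basic bound for `W`-dominated measurable functions
  have hint : ∀ {φ : PhaseSpace N → ℝ}, Measurable φ → ∀ {M : ℝ}, (∀ y, |φ y| ≤ M * W y) →
      ∀ x, Integrable φ (R x) := by
    intro φ hφm M hφ x
    refine Harris.integrable_of_abs_le_affine hVm (hVR x) hφm (A := M * c₀) (B := M) fun y => ?_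
    have := hφ y
    simp only [hW] at this
    linarith
  have hbound : ∀ {φ : PhaseSpace N → ℝ}, Measurable φ → ∀ {M : ℝ}, 0 ≤ M → (∀ y, |φ y| ≤ M * W y) →
      ∀ x, |∫ y, φ y ∂(R x)| ≤ M * ((V x : ℝ) + K₀ + c₀) := by
    intro φ hφm M hM hφ x
    have h1 := Harris.abs_integral_le_of_abs_le_affine hVm (hVR x) hφm (A := M * c₀) (B := M) fun y => by
      have := hφ y
      simp only [hW] at this
      linarith
    rw [probReal_univ, mul_one] at h1
    have h2 := mul_le_mul_of_nonneg_left (hRbound x) hM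
    linarith
  -- the flip part `r⁻¹ ε Σ_i f ∘ F_i` of the datum: measurability, bound, contraction under `R`
  have hGm : ∀ {f : PhaseSpace N → ℝ}, Measurable f →
      Measurable fun y => r⁻¹ * (ε * ∑ i : Fin N, f (momentumFlip i y)) := fun hf =>
    ((Finset.measurable_sum _ fun i _ => hf.comp (measurable_momentumFlip i)).const_mul _).const_mul _
  have hGb : ∀ {f : PhaseSpace N → ℝ} {M : ℝ}, (∀ y, |f y| ≤ M * W y) →
      ∀ y, |r⁻¹ * (ε * ∑ i : Fin N, f (momentumFlip i y))| ≤ r⁻¹ * ε * N * M * W y := by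
    intro f M hf y
    rw [abs_mul, abs_mul, abs_of_pos (inv_pos.2 hr), abs_of_pos hε]
    have h1 : |∑ i : Fin N, f (momentumFlip i y)| ≤ N * (M * W y) := by
      calc |∑ i : Fin N, f (momentumFlip i y)| ≤ ∑ i : Fin N, |f (momentumFlip i y)| :=
            Finset.abs_sum_le_sum_abs _ _
        _ ≤ ∑ _i : Fin N, M * W y := Finset.sum_le_sum fun i _ => by
            have := hf (momentumFlip i y); rwa [hWflip] at this
        _ = N * (M * W y) := by rw [Finset.sum_const, Finset.card_univ, Fintype.card_fin, nsmul_eq_mul]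
    have h2 : r⁻¹ * (ε * |∑ i : Fin N, f (momentumFlip i y)|) ≤ r⁻¹ * (ε * (N * (M * W y))) :=
      mul_le_mul_of_nonneg_left (mul_le_mul_of_nonneg_left h1 hε.le) (inv_pos.2 hr).le
    linarith
  have hGcontr : ∀ {f : PhaseSpace N → ℝ}, Measurable f → ∀ {M : ℝ}, 0 ≤ M → (∀ y, |f y| ≤ M * W y) →
      ∀ x, |∫ y, r⁻¹ * (ε * ∑ i : Fin N, f (momentumFlip i y)) ∂(R x)| ≤ q * M * W x := by
    intro f hf M hM hfb x
    have h1 := hbound (hGm hf) (by positivity : 0 ≤ r⁻¹ * ε * N * M) (hGb hfb) x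
    have hV0 : (0 : ℝ) ≤ V x := (V x).coe_nonneg
    have e : q * M * W x - r⁻¹ * ε * N * M * ((V x : ℝ) + K₀ + c₀) = r⁻¹ * M * (s / 2) * V x := by
      simp only [hq, hW, hc₀]
      field_simp
      ring
    have h3 : 0 ≤ r⁻¹ * M * (s / 2) * V x := by positivity
    linarith
  -- the source `ψ = R (r⁻¹ J)`
  obtain ⟨CJ, hCJ0, hCJ⟩ := abs_totalCurrent_le_exp (N := N) hω.le hl.le hβ.le γ hθ0
  set J : PhaseSpace N → ℝ := fun y => ∑ i : Fin N, P.bondCurrent N i y with hJ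
  have hJc : Continuous J := by
    simp only [hJ]
    exact continuous_finsetSum _ fun i _ => pinnedChain_continuous_bondCurrent ω₂ lam β γ N i
  have hJm : Measurable fun y => r⁻¹ * J y := hJc.measurable.const_mul _
  have hJb : ∀ y, |r⁻¹ * J y| ≤ r⁻¹ * CJ * W y := by
    intro y
    rw [abs_mul, abs_of_pos (inv_pos.2 hr)]
    have h1 := hCJ y
    rw [← hVreal] at h1
    have h2 := mul_le_mul_of_nonneg_left (hVW y) hCJ0
    have h3 : r⁻¹ * |J y| ≤ r⁻¹ * (CJ * W y) := mul_le_mul_of_nonneg_left (h1.trans h2) (inv_pos.2 hr).le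
    linarith
  set ψ : PhaseSpace N → ℝ := fun z => ∫ y, r⁻¹ * J y ∂(R z) with hψ
  have hψm : Measurable ψ := (hJm.stronglyMeasurable.integral_kernel (κ := R)).measurable
  set M₀ : ℝ := r⁻¹ * CJ * (1 + K₀) with hM₀
  have hM₀0 : 0 ≤ M₀ := by positivity
  have hψb : ∀ z, |ψ z| ≤ M₀ * W z := by
    intro z
    have h1 := hbound hJm (by positivity) hJb z
    have h2 : (V z : ℝ) + K₀ + c₀ ≤ (1 + K₀) * W z := by
      simp only [hW]; nlinarith [hVge1 z, hK₀0, hc₀0]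
    calc |ψ z| ≤ r⁻¹ * CJ * ((V z : ℝ) + K₀ + c₀) := h1
      _ ≤ r⁻¹ * CJ * ((1 + K₀) * W z) := mul_le_mul_of_nonneg_left h2 (by positivity)
      _ = M₀ * W z := by rw [hM₀]; ring
  -- (2) the Banach iterates `d n = Gⁿ ψ`, `|d n| ≤ M₀ qⁿ W`
  set G : (PhaseSpace N → ℝ) → PhaseSpace N → ℝ :=
    fun f x => ∫ y, r⁻¹ * (ε * ∑ i : Fin N, f (momentumFlip i y)) ∂(R x) with hG
  set d : ℕ → PhaseSpace N → ℝ := fun n => G^[n] ψ with hd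
  have hd0 : d 0 = ψ := rfl
  have hdsucc : ∀ n, d (n + 1) = G (d n) := fun n => Function.iterate_succ_apply' G n ψ
  have hdm : ∀ n, Measurable (d n) ∧ ∀ z, |d n z| ≤ M₀ * q ^ n * W z := by
    intro n
    induction n with
    | zero => exact ⟨hψm, fun z => by rw [hd0, pow_zero, mul_one]; exact hψb z⟩
    | succ n ih =>
      refine ⟨?_, fun z => ?_⟩
      · rw [hdsucc]
        exact ((hGm ih.1).stronglyMeasurable.integral_kernel (κ := R)).measurable
      · rw [hdsucc]
        calc |G (d n) z| ≤ q * (M₀ * q ^ n) * W z := hGcontr ih.1 (by positivity) ih.2 z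
          _ = M₀ * q ^ (n + 1) * W z := by ring
  -- (3) the sum `u = Σ_n d n`
  have hgeo : Summable fun n : ℕ => M₀ * q ^ n := (summable_geometric_of_lt_one hq0 hq1).mul_left M₀
  have hsumm : ∀ x, Summable fun n => d n x := fun x =>
    Summable.of_norm_bounded (g := fun n => M₀ * q ^ n * W x) (hgeo.mul_right (W x)) fun n => by
      rw [Real.norm_eq_abs]; exact (hdm n).2 x
  set u : PhaseSpace N → ℝ := fun x => ∑' n, d n x with hu
  have hum : Measurable u := by
    refine measurable_of_tendsto_metrizable (f := fun m x => ∑ n ∈ Finset.range m, d n x)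
      (fun m => Finset.measurable_sum _ fun n _ => (hdm n).1) ?_
    rw [tendsto_pi_nhds]
    exact fun x => (hsumm x).hasSum.tendsto_sum_nat
  set M : ℝ := M₀ / (1 - q) with hMdef
  have hM0 : 0 ≤ M := by positivity
  have hub : ∀ x, |u x| ≤ M * W x := by
    intro x
    have h1 : ‖∑' n, d n x‖ ≤ ∑' n : ℕ, M₀ * q ^ n * W x :=
      tsum_of_norm_bounded (hgeo.mul_right (W x)).hasSum fun n => by rw [Real.norm_eq_abs]; exact (hdm n).2 x
    rw [tsum_mul_right, tsum_mul_left, tsum_geometric_of_lt_one hq0 hq1] at h1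
    rw [Real.norm_eq_abs] at h1
    calc |u x| ≤ M₀ * (1 - q)⁻¹ * W x := h1
      _ = M * W x := by rw [hMdef, div_eq_mul_inv]
  -- (4) `G u = Σ_n d (n+1)` (integral of the sum, dominated by a geometric series times `W`)
  have hVcoe : ∀ x, ((V x : ℝ≥0) : ℝ≥0∞) = ENNReal.ofReal (V x : ℝ) := fun x => by
    rw [ENNReal.ofReal_coe_nnreal]
  have hWint : ∀ x, ∫⁻ y, ENNReal.ofReal (W y) ∂(R x) ≠ ⊤ := by
    intro x
    have e : ∀ y, ENNReal.ofReal (W y) = (V y : ℝ≥0∞) + ENNReal.ofReal c₀ := by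
      intro y
      simp only [hW]
      rw [ENNReal.ofReal_add (V y).coe_nonneg hc₀0, hVcoe]
    simp_rw [e]
    rw [lintegral_add_right _ measurable_const, lintegral_const, measure_univ, mul_one]
    exact ENNReal.add_ne_top.2 ⟨hVR x, ENNReal.ofReal_ne_top⟩
  have e1 : ∀ y, r⁻¹ * (ε * ∑ i : Fin N, u (momentumFlip i y)) =
      ∑' n, r⁻¹ * (ε * ∑ i : Fin N, d n (momentumFlip i y)) := by
    intro y
    rw [tsum_mul_left, tsum_mul_left, Summable.tsum_finsetSum (fun i _ => hsumm (momentumFlip i y))]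
  have hGu : ∀ x, G u x = ∑' n, d (n + 1) x := by
    intro x
    have e2 : ∀ n, d (n + 1) x = ∫ y, r⁻¹ * (ε * ∑ i : Fin N, d n (momentumFlip i y)) ∂(R x) := fun n => by
      rw [hdsucc]
    simp only [hG, e2]
    rw [integral_congr_ae (ae_of_all _ e1), integral_tsum (fun n => (hGm (hdm n).1).aestronglyMeasurable)]
    -- `Σ_n ∫⁻ |g n| dR x ≤ Σ_n (r⁻¹ ε N M₀) qⁿ ∫⁻ W dR x < ∞`
    have hWm : Measurable fun y => ENNReal.ofReal (W y) := by
      refine ENNReal.measurable_ofReal.comp ?_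
      simp only [hW]
      exact (measurable_coe_nnreal_real.comp hVm).add_const _
    have hle : ∀ n, ∫⁻ y, ‖r⁻¹ * (ε * ∑ i : Fin N, d n (momentumFlip i y))‖ₑ ∂(R x) ≤
        ENNReal.ofReal (r⁻¹ * ε * N * M₀) * ENNReal.ofReal q ^ n * ∫⁻ y, ENNReal.ofReal (W y) ∂(R x) := by
      intro n
      rw [← lintegral_const_mul _ hWm]
      refine lintegral_mono fun y => ?_
      rw [Real.enorm_eq_ofReal_abs, ← ENNReal.ofReal_pow hq0, ← ENNReal.ofReal_mul (by positivity),
        ← ENNReal.ofReal_mul (by positivity)]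
      refine ENNReal.ofReal_le_ofReal ?_
      have := hGb (hdm n).2 y
      calc |r⁻¹ * (ε * ∑ i : Fin N, d n (momentumFlip i y))| ≤ r⁻¹ * ε * N * (M₀ * q ^ n) * W y := this
        _ = r⁻¹ * ε * N * M₀ * q ^ n * W y := by ring
    refine ne_top_of_le_ne_top ?_ (ENNReal.tsum_le_tsum hle)
    rw [ENNReal.tsum_mul_right, ENNReal.tsum_mul_left, ENNReal.tsum_geometric]
    refine ENNReal.mul_ne_top (ENNReal.mul_ne_top ENNReal.ofReal_ne_top ?_) (hWint x)
    exact ENNReal.inv_ne_top.2 (tsub_pos_of_lt (ENNReal.ofReal_lt_one.2 hq1)).ne'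
  -- (5) the fixed-point equation `u = ψ + G u`
  have hfix : ∀ x, u x = ψ x + G u x := by
    intro x
    rw [hGu x]
    simp only [hu]
    rw [(hsumm x).tsum_eq_zero_add, hd0]
  -- (6) conclusion
  have hQm : Measurable fun y => r⁻¹ * (ε * ∑ i : Fin N, u (momentumFlip i y)) := hGm hum
  refine ⟨u, hum, ⟨M * (1 + c₀), fun z => ?_⟩, fun z => ?_⟩
  · -- the exponential bound: `M W ≤ M (1 + c₀) V`
    rw [← hVreal z]
    have h1 := hub z
    have h2 : W z ≤ (1 + c₀) * (V z : ℝ) := by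
      simp only [hW]; nlinarith [hVge1 z, hc₀0]
    calc |u z| ≤ M * W z := h1
      _ ≤ M * ((1 + c₀) * (V z : ℝ)) := mul_le_mul_of_nonneg_left h2 hM0
      _ = M * (1 + c₀) * (V z : ℝ) := by ring
  · -- the mild equation
    rw [hfix z]
    simp only [hψ, hG]
    rw [← integral_add (hint hJm hJb z) (hint hQm (hGb hub) z)]
    refine integral_congr_ae (ae_of_all _ fun y => ?_)
    simp only [hJ]
    ring

end Mild

/-! ## Registered helper -/

/-- Registered helper sub-goal `helper_abelCorrectorMild` of stub `stub_abelCorrectorExists` (line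
`abel-kapitza-even-corrector`, crux stmt-AtomisticToContinuum-11977): existence of a measurable,
`e^{H/(4T)}`-bounded MILD Abel corrector `u = R_{s+Nε}((s+Nε)⁻¹(J + ε Σ_i u ∘ F_i))` of the velocity-flip pinned
chain (`abel_mildCorrector_exists`). [cite: BernardinOlla2011, §5] -/
theorem helper_abelCorrectorMild : ∀ (ω₂ lam β γ : ℝ) (hω : 0 < ω₂) (hl : 0 < lam) (hβ : 0 < β) (hγ : 0 < γ) (N : ℕ) (hN : 1 < N) (T : ℝ) (hT : 0 < T) (ε : ℝ), 0 < ε → ∀ (s : ℝ), 0 < s → ∃ u : Literature.MathematicalPhysics.KineticTheory.HeatConduction.PhaseSpace N → ℝ, Measurable u ∧ (∃ C : ℝ, ∀ z, |u z| ≤ C * Real.exp (1 / (4 * T) * (Literature.MathematicalPhysics.KineticTheory.HeatConduction.pinnedChain ω₂ lam β γ).hamiltonian N z)) ∧ ∀ z, u z = MeasureTheory.integral ((Literature.MathematicalPhysics.KineticTheory.HeatConduction.pinnedChainSemigroup hω (le_of_lt hl) (le_of_lt hβ) (le_of_lt hγ) (Nat.zero_lt_of_lt hN) (le_of_lt hT)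 (le_of_lt hT)).resolventKernel (s + (N : ℝ) * ε) z) (fun y => (s + (N : ℝ) * ε)⁻¹ * ((∑ i : Fin N, (Literature.MathematicalPhysics.KineticTheory.HeatConduction.pinnedChain ω₂ lam β γ).bondCurrent N i y) + ε * ∑ i : Fin N, u (Literature.MathematicalPhysics.KineticTheory.HeatConduction.momentumFlip i y))) :=
  fun _ _ _ _ hω hl hβ hγ _ hN _ hT _ hε _ hs => abel_mildCorrector_exists hω hl hβ hγ hN hT hε hs

end Summit.AtomisticToContinuum.FouriersLaw.Cruxes.NoisyFourier.AbelKapitzaEvenCorrector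

end
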